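import Summits.Ventures.LatticeQCDFlow.Scaling.UntouchedReplicas
import Summits.Ventures.LatticeQCDFlow.Scaling.ExchangeSchemeCollector
import Literature.Probability.MarkovChains.ProductHeatKernel

/-!
HONEST FRAMING: exact (Metropolis-corrected) sampling algorithms for lattice gauge theory; figures
of merit are autocorrelation/cost numbers at stated couplings and volumes; no continuum-physics
claim.

# ProductRefreshAugmentation — THE RANDOM-SCAN EXACT REFRESH (`d` COORDINATES, COORDINATE `k` DRAWN WITH PROBABILITY
# `w_k` AND REDRAWN FROM ITS OWN LAW `μ_k`) TAGGED WITH ITS STALE SET: THE AUGMENTED CHAIN LUMPS ONTO THE PRODUCT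
# CHAIN AND ONTO THE TOUCH CHAIN `R(U,V) = Σ_k w_k·𝟙{V = U ∖ {k}}`, AND ITS ONE-STEP ACTION ON LAWS IS EXPLICIT
# (lean-2 GEN-24, ours)

Venture-side (OURS).  Cell `lqcd-flow` (pub-lqcd), unit `pub-lqcd-lean-2-g24`, 2026-08-27.  Chapter L (the coupon-collector
law from a cold start), file 18 — the ceiling side for the swap-free end of the chapter.  The product chain
`prodKernel w M` of `Literature/…/ProductChains` on `Fin d → S` with EXACT coordinate samplers `M_k(u,v) = μ_k(v)`
(independent redraws; the `t = 0`, all-levels-hot analogue of the idealised star of `Scaling/IdealStarAugmentation`).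
The AUGMENTED CHAIN on `(Fin d → S) × Finset (Fin d)` carries the STALE SET (coordinates not yet redrawn):
`P̂((z,D),(z',D')) = Σ_k w_k·coordKernel M k (z,z')·𝟙{D' = D ∖ {k}}`; its tag marginal is exactly the touch chain of
`Scaling/UntouchedReplicas` / `Scaling/TouchChainMoments` with `τ k = {k}`, `c = w`.

## What is proved

* §1 `sum_coordKernel_row` (`Σ_{z'} coordKernel M k (z,z') = 1`); the column form
  `Σ_z f(z)·coordKernel M k (z,z') = Σ_u f(z'[k ↦ u])·M_k(u, z'_k)` is `Literature/…/ProductHeatKernel`'s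
  `sum_mul_coordKernel` [cite: LevinPeres2017, §20.4 eq. (20.22)], imported.
* §2 `refresh_aug_isRowStochastic`; **`refresh_lump_fst`** (configuration marginal = `prodKernel w M`),
  **`refresh_lump_snd`** (stale-set marginal = the touch chain); **`refresh_lawAt_fst`** / **`refresh_lawAt_snd`**.
* §3 **`refresh_stepLaw_apply`** — `(λP̂)(z',D') = Σ_k w_k·Σ_{D : D∖{k} = D'} Σ_u λ(z'[k ↦ u], D)·M_k(u, z'_k)`.

Reading (no numerics implied): bookkeeping for `Scaling/ProductRefreshCeiling`, which shows that clean coordinates are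
exactly `μ_k`-distributed and derives the `d·log d` mixing CEILING matching `Scaling/ProductChainCollectorLaw`'s
floor.  NOT CLAIMED: inexact coordinate samplers.  Literature grade (cell rule): OWN CONSTRUCTION; nothing cited as a
fact; no new bib keys.
-/

noncomputable section

open Finset Function
open Literature.Probability.MarkovChains

namespace Summit.Ventures.LatticeQCDFlow.Scaling

variable {S : Type*} [Fintype S] [DecidableEq S] {d : ℕ} {μ : Fin d → S → ℝ} {M : Fin d → S → S → ℝ} {w : Fin d → ℝ}

/-! ## §1 Row sums of a coordinate kernel -/

/-- `Σ_{z'} coordKernel M k (z,z') = 1` (`M_k` row-stochastic). [ours] -/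
theorem sum_coordKernel_row (hM : ∀ k, IsRowStochastic (M k)) (k : Fin d) (z : Fin d → S) :
    ∑ z', coordKernel M k z z' = 1 := by
  have h := sum_coordKernel_mul M k z (fun _ => (1 : ℝ))
  simp only [mul_one] at h
  rw [h, (hM k).2]

/-! ## §2 The augmented chain and its lumpings -/

/-- The augmented refresh chain is a transition matrix (`w` a probability vector, `M_k` row-stochastic). [ours] -/
theorem refresh_aug_isRowStochastic (hw0 : ∀ k, 0 ≤ w k) (hw1 : ∑ k, w k = 1) (hM : ∀ k, IsRowStochastic (M k))
    {Ph : (Fin d → S) × Finset (Fin d) → (Fin d → S) × Finset (Fin d) → ℝ}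
    (hPh : ∀ p q, Ph p q = ∑ k : Fin d, w k * (coordKernel M k p.1 q.1 * (if q.2 = p.2 \ {k} then (1 : ℝ) else 0))) :
    IsRowStochastic Ph := by
  refine ⟨fun p q => ?_, fun p => ?_⟩
  · rw [hPh]
    exact sum_nonneg fun k _ => mul_nonneg (hw0 k) (mul_nonneg (coordKernel_nonneg M (fun j u v => (hM j).1 u v) k _ _)
      (by split_ifs <;> norm_num))
  · simp_rw [hPh]
    rw [Finset.sum_comm]
    have h : ∀ k : Fin d, ∑ q : (Fin d → S) × Finset (Fin d),
        w k * (coordKernel M k p.1 q.1 * (if q.2 = p.2 \ {k} then (1 : ℝ) else 0)) = w k := by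
      intro k
      rw [← Finset.mul_sum, Fintype.sum_prod_type]
      have : ∀ z : Fin d → S, ∑ D : Finset (Fin d),
          coordKernel M k p.1 (z, D).1 * (if (z, D).2 = p.2 \ {k} then (1 : ℝ) else 0) = coordKernel M k p.1 z := by
        intro z
        dsimp only
        rw [← Finset.mul_sum, Finset.sum_ite_eq' univ (p.2 \ {k}), if_pos (mem_univ _), mul_one]
      simp_rw [this]
      rw [sum_coordKernel_row hM k p.1, mul_one]
    simp_rw [h]
    exact hw1

/-- **FIRST LUMPING: the configuration marginal is the product chain.** [ours] -/
theorem refresh_lump_fst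
    {Ph : (Fin d → S) × Finset (Fin d) → (Fin d → S) × Finset (Fin d) → ℝ}
    (hPh : ∀ p q, Ph p q = ∑ k : Fin d, w k * (coordKernel M k p.1 q.1 * (if q.2 = p.2 \ {k} then (1 : ℝ) else 0)))
    (p : (Fin d → S) × Finset (Fin d)) (z' : Fin d → S) :
    prodKernel w M p.1 z' = ∑ q ∈ univ.filter (fun q : (Fin d → S) × Finset (Fin d) => q.1 = z'), Ph p q := by
  rw [sum_filter_prodFst_eq, prodKernel_apply]
  simp_rw [hPh]
  rw [Finset.sum_comm]
  refine sum_congr rfl fun k _ => ?_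
  rw [← Finset.mul_sum]
  congr 1
  rw [← Finset.mul_sum, Finset.sum_ite_eq' univ (p.2 \ {k}), if_pos (mem_univ _), mul_one]

/-- **SECOND LUMPING: the stale-set marginal is the touch chain `R(U,V) = Σ_k w_k·𝟙{V = U ∖ {k}}`.** [ours] -/
theorem refresh_lump_snd (hM : ∀ k, IsRowStochastic (M k))
    {Ph : (Fin d → S) × Finset (Fin d) → (Fin d → S) × Finset (Fin d) → ℝ}
    (hPh : ∀ p q, Ph p q = ∑ k : Fin d, w k * (coordKernel M k p.1 q.1 * (if q.2 = p.2 \ {k} then (1 : ℝ) else 0)))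
    {R : Finset (Fin d) → Finset (Fin d) → ℝ}
    (hR : ∀ U V, R U V = ∑ k : Fin d, w k * (if V = U \ ({k} : Finset (Fin d)) then (1 : ℝ) else 0))
    (p : (Fin d → S) × Finset (Fin d)) (D' : Finset (Fin d)) :
    R p.2 D' = ∑ q ∈ univ.filter (fun q : (Fin d → S) × Finset (Fin d) => q.2 = D'), Ph p q := by
  rw [sum_filter_prodSnd_eq, hR]
  simp_rw [hPh]
  rw [Finset.sum_comm]
  refine sum_congr rfl fun k _ => ?_
  rw [← Finset.mul_sum]
  congr 1
  calc (if D' = p.2 \ {k} then (1 : ℝ) else 0)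
      = (∑ z : Fin d → S, coordKernel M k p.1 z) * (if D' = p.2 \ {k} then (1 : ℝ) else 0) := by
        rw [sum_coordKernel_row hM k p.1, one_mul]
    _ = ∑ z : Fin d → S, coordKernel M k p.1 z * (if D' = p.2 \ {k} then (1 : ℝ) else 0) := Finset.sum_mul _ _ _

/-- **From `δ_{(x, univ)}`: the configuration marginal at time `n` is `δ_x (prodKernel w M)ⁿ`.** [ours] -/
theorem refresh_lawAt_fst
    {Ph : (Fin d → S) × Finset (Fin d) → (Fin d → S) × Finset (Fin d) → ℝ}
    (hPh : ∀ p q, Ph p q = ∑ k : Fin d, w k * (coordKernel M k p.1 q.1 * (if q.2 = p.2 \ {k} then (1 : ℝ) else 0)))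
    (x : Fin d → S) (n : ℕ) (z : Fin d → S) :
    ∑ D : Finset (Fin d), lawAt Ph (Pi.single (x, (univ : Finset (Fin d))) 1) n (z, D)
      = lawAt (prodKernel w M) (Pi.single x 1) n z := by
  rw [← sum_filter_prodFst_eq (fun q => lawAt Ph (Pi.single (x, (univ : Finset (Fin d))) 1) n q) z,
    LevinPeres2017_lemma_2_5_lawAt (P := Ph) (proj := Prod.fst) (Ps := prodKernel w M) (fun p z' => refresh_lump_fst hPh p z')]
  congr 1
  funext z'
  exact sum_filter_prodFst_single x univ z'

/-- **From `δ_{(x, univ)}`: the stale-set marginal at time `n` is `δ_{univ} Rⁿ` — the same for every start.** [ours] -/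
theorem refresh_lawAt_snd (hM : ∀ k, IsRowStochastic (M k))
    {Ph : (Fin d → S) × Finset (Fin d) → (Fin d → S) × Finset (Fin d) → ℝ}
    (hPh : ∀ p q, Ph p q = ∑ k : Fin d, w k * (coordKernel M k p.1 q.1 * (if q.2 = p.2 \ {k} then (1 : ℝ) else 0)))
    {R : Finset (Fin d) → Finset (Fin d) → ℝ}
    (hR : ∀ U V, R U V = ∑ k : Fin d, w k * (if V = U \ ({k} : Finset (Fin d)) then (1 : ℝ) else 0))
    (x : Fin d → S) (n : ℕ) (D : Finset (Fin d)) :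
    ∑ z : Fin d → S, lawAt Ph (Pi.single (x, (univ : Finset (Fin d))) 1) n (z, D)
      = lawAt R (Pi.single (univ : Finset (Fin d)) 1) n D := by
  rw [← sum_filter_prodSnd_eq (fun q => lawAt Ph (Pi.single (x, (univ : Finset (Fin d))) 1) n q) D,
    LevinPeres2017_lemma_2_5_lawAt (P := Ph) (proj := Prod.snd) (Ps := R) (fun p D' => refresh_lump_snd hM hPh hR p D')]
  congr 1
  funext D'
  exact sum_filter_prodSnd_single x univ D'

/-! ## §3 The one-step action on laws -/

/-- **THE ONE-STEP ACTION OF THE AUGMENTED REFRESH CHAIN ON A LAW `λ`:**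
`(λP̂)(z',D') = Σ_k w_k·Σ_{D : D∖{k} = D'} Σ_u λ(z'[k ↦ u], D)·M_k(u, z'_k)`. [ours] -/
theorem refresh_stepLaw_apply
    {Ph : (Fin d → S) × Finset (Fin d) → (Fin d → S) × Finset (Fin d) → ℝ}
    (hPh : ∀ p q, Ph p q = ∑ k : Fin d, w k * (coordKernel M k p.1 q.1 * (if q.2 = p.2 \ {k} then (1 : ℝ) else 0)))
    (lam : (Fin d → S) × Finset (Fin d) → ℝ) (z' : Fin d → S) (D' : Finset (Fin d)) :
    stepLaw Ph lam (z', D')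
      = ∑ k : Fin d, w k * ∑ D ∈ univ.filter (fun D : Finset (Fin d) => D \ ({k} : Finset (Fin d)) = D'),
          ∑ u : S, lam (update z' k u, D) * M k u (z' k) := by
  unfold stepLaw
  simp_rw [hPh, Finset.mul_sum]
  rw [Finset.sum_comm]
  refine sum_congr rfl fun k _ => ?_
  rw [Fintype.sum_prod_type, Finset.sum_comm, Finset.sum_filter]
  dsimp only
  refine sum_congr rfl fun D _ => ?_
  by_cases hD : D' = D \ ({k} : Finset (Fin d))
  · simp_rw [if_pos hD, mul_one, if_pos hD.symm]
    have h := sum_mul_coordKernel M k z' (fun z => lam (z, D))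
    calc ∑ z, lam (z, D) * (w k * coordKernel M k z z')
        = w k * ∑ z, lam (z, D) * coordKernel M k z z' := by
          rw [Finset.mul_sum]; exact sum_congr rfl fun z _ => by ring
      _ = w k * ∑ u : S, lam (update z' k u, D) * M k u (z' k) := by rw [h]
      _ = ∑ u : S, w k * (lam (update z' k u, D) * M k u (z' k)) := by rw [Finset.mul_sum]
  · simp_rw [if_neg hD, mul_zero, if_neg (fun h : D \ ({k} : Finset (Fin d)) = D' => hD h.symm)]
    simp

end Summit.Ventures.LatticeQCDFlow.Scaling

end
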